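import Summits.AtomisticToContinuum.Crystallization.Theorems.FrustratedLawDichotomyFrustrationFrequency
import Summits.AtomisticToContinuum.Crystallization.Theorems.FrustratedLawDichotomyTextureCoarseSites

/-!
# FrustratedLawDichotomy · crux `AperiodicFrustratedLawGap` (stmt-AtomisticToContinuum-27623) — the frequency theorems, HULL-FREE

decomp-a2c · prover hand 1 · generation 8.  The frequency theorems of hand-1 g6 (`inv_le_prob_frustratedFineRoot`,
`inv_le_prob_holeOrNonTRoot` in `…FrustrationFrequency`, `inv_le_prob_coarseRoot` in `…TextureCoarseSites`) were stated in HULL FORM —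
«every MEASURABLE set containing all configurations whose root is frustrated has `P ≥ 1/C`» — because the root events themselves were not
shown measurable (census debt (3) of the hand-1 g7 repair census).  That debt is moot for the lower bounds: in Mathlib the measure of an
ARBITRARY set is its outer measure, `P E = ⨅ {P A | A ⊇ E measurable}` (`MeasureTheory.measure_eq_iInf`), so the hull form already yields the
direct bound `1/C ≤ P {μ | root frustrated}` with NO measurability.  This file records the three hull-free corollaries; the statements are
VERBATIM the originals with the hull quantifier `∀ A, MeasurableSet A → (∀ ν, … → ν ∈ A) → C⁻¹ ≤ P A` replaced by `C⁻¹ ≤ P {ν | …}`.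
DEF-FREE; axioms standard.
-/

noncomputable section

namespace Summit.AtomisticToContinuum.Crystallization.Theorems.FrustratedLawDichotomyFrequencyHullFree

open MeasureTheory Metric Set Filter ProbabilityTheory
open scoped ENNReal
open Literature.Probability.Process
open Summit.AtomisticToContinuum.Crystallization.Theorems.FrustratedLawDichotomyFrustrationFrequency
open Summit.AtomisticToContinuum.Crystallization.Theorems.FrustratedLawDichotomyTextureCoarseSites

/-- **THE FRUSTRATION FREQUENCY, hull-free**: under clauses (a)(b)(d) of the crux, the event «root fine up to `1/8+ε` AND not robustly
`1/20`-good» has probability `≥ 1/C(δ, R₈+ε)` — outer-measure form of `inv_le_prob_frustratedFineRoot`. [this work] -/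
theorem inv_le_prob_frustratedFineRoot_hullFree :
    ∀ δ : ℝ, 0 < δ → ∀ R₈ ε : ℝ, 0 < ε → ∃ C : ℕ,
    ∀ P : MeasureTheory.Measure (MeasureTheory.Measure (EuclideanSpace ℝ (Fin 3))), let Gy : ℝ → (N : ℕ) → (Fin N → EuclideanSpace ℝ (Fin 3)) → Fin N → Prop := fun η N y j => let d : ℝ := sInf ((fun z => dist z (y (j : Fin N))) '' (Set.range (y) \ {(y (j : Fin N))})); let T : Set (EuclideanSpace ℝ (Fin 3)) := {z : EuclideanSpace ℝ (Fin 3) | z ∈ Set.range (y) ∧ z ≠ (y (j : Fin N)) ∧ dist z (y (j : Fin N)) < 13 / 10 * d}; ∃ A : EuclideanSpace ℝ (Fin 3) →ₗᵢ[ℝ] EuclideanSpace ℝ (Fin 3), (∃ e : ↥T ≃ ↥Literature.Geometry.DiscreteGeometry.fccKissingPattern, ∀ t : ↥T, dist (d⁻¹ • ((t : EuclideanSpace ℝ (Fin 3)) - (y (j : Fin N)))) (A ((e t : ↥Literature.Geometry.DiscreteGeometry.fccKissingPattern) : EuclideanSpace ℝ (Fin 3))) ≤ η) ∨ (∃ e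 : ↥T ≃ ↥Literature.Geometry.DiscreteGeometry.hcpKissingPattern, ∀ t : ↥T, dist (d⁻¹ • ((t : EuclideanSpace ℝ (Fin 3)) - (y (j : Fin N)))) (A ((e t : ↥Literature.Geometry.DiscreteGeometry.hcpKissingPattern) : EuclideanSpace ℝ (Fin 3))) ≤ η); let TexBall : (N : ℕ) → (Fin N → EuclideanSpace ℝ (Fin 3)) → Fin N → ℝ → ℝ → ℝ → ℝ → Prop := fun N y i R R₇ R₈ R₉ => (∀ a b : Fin N, a ≠ b → (7 : ℝ) / 10 ≤ dist (y a) (y b)) ∧ (∀ j : Fin N, dist (y j) (y i) ≤ R → ¬ Gy (1 / 20) N (y) j) ∧ (∀ j : Fin N, dist (y j) (y i) ≤ R → ¬ ((∀ j' : Fin N, dist (y j') (y j) ≤ R₇ → ¬ Gy (1 / 20) N (y) j') ∧ (∀ z : EuclideanSpace ℝ (Fin 3), dist z (y j) ≤ R₇ → ∃ k : Fin N, dist z (y k) ≤ 1) ∧ (∀ j' : Fin N, dist (y j') (y j) ≤ R₇ → (let d : ℝ := sInf ((fun z => dist z (y j')) '' (Set.range (y) \ {(y j')})); ∀ k : Fin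 N, y k ≠ y j' → dist (y k) (y j') < 27 / 20 * d → 5 ≤ Nat.card {m : Fin N // y m ≠ y j' ∧ dist (y m) (y j') < 27 / 20 * d ∧ y m ≠ y k ∧ dist (y m) (y k) < 27 / 20 * d})))) ∧ (∀ j : Fin N, dist (y j) (y i) ≤ R → ∃ k : Fin N, dist (y k) (y j) ≤ R₈ ∧ Gy (1 / 8) N (y) k) ∧ (∀ j : Fin N, dist (y j) (y i) ≤ R → ¬ ((∀ j' : Fin N, dist (y j') (y j) ≤ R₉ → ¬ Gy (1 / 20) N (y) j') ∧ (Nat.card {j' : Fin N // dist (y j') (y j) ≤ R₉ ∧ ¬ Gy (1 / 8) N (y) j'} : ℝ) ≤ 1 / 2 * (Nat.card {j' : Fin N // dist (y j') (y j) ≤ R₉} : ℝ) ∧ (∀ j' : Fin N, dist (y j') (y j) ≤ R₉ → ¬ Gy (1 / 8) N (y) j' → ¬ (let d : ℝ := sInf ((fun z => dist z (y j')) '' (Set.range (y) \ {(y j')})); ∀ k : Fin N, y k ≠ y j' → dist (y k) (y j') < 27 / 20 * d → 5 ≤ Nat.card {m : Fin N // y m ≠ y j' ∧ dist (y m) (y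 j') < 27 / 20 * d ∧ y m ≠ y k ∧ dist (y m) (y k) < 27 / 20 * d})))); let Appr : MeasureTheory.Measure (EuclideanSpace ℝ (Fin 3)) → ℝ → ℝ → ℝ → Prop := fun μ R₇ R₈ R₉ => ∀ q : EuclideanSpace ℝ (Fin 3), μ {q} ≠ 0 → ∀ R ε : ℝ, 0 < ε → ∃ (N : ℕ) (y : Fin N → EuclideanSpace ℝ (Fin 3)) (i : Fin N), TexBall N y i R R₇ R₈ R₉ ∧ (∀ p : EuclideanSpace ℝ (Fin 3), μ {p} ≠ 0 → dist p q ≤ R → ∃ k : Fin N, dist (y k - y i) (p - q) ≤ ε) ∧ (∀ k : Fin N, dist (y k) (y i) ≤ R → ∃ p : EuclideanSpace ℝ (Fin 3), μ {p} ≠ 0 ∧ dist (y k - y i) (p - q) ≤ ε);  MeasureTheory.IsProbabilityMeasure P → (∀ᵐ μ ∂P, Literature.Probability.Process.IsRootedHardCore δ μ) → Literature.Probability.Process.IsPointStationaryLaw P → ∀ R₇ R₉ : ℝ, (∀ᵐ μ ∂P, Appr μ R₇ R₈ R₉) →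
        (C : ℝ≥0∞)⁻¹ ≤ P {ν : MeasureTheory.Measure (EuclideanSpace ℝ (Fin 3)) |
          ((∃ d : ℝ, (7 : ℝ) / 10 ≤ d ∧ (∀ s : EuclideanSpace ℝ (Fin 3), ν {s} ≠ 0 → s ≠ 0 → d ≤ ‖s‖ + ε) ∧
            ∃ A : EuclideanSpace ℝ (Fin 3) →ₗᵢ[ℝ] EuclideanSpace ℝ (Fin 3),
              ((∀ u ∈ Literature.Geometry.DiscreteGeometry.fccKissingPattern, ∃ s : EuclideanSpace ℝ (Fin 3), ν {s} ≠ 0 ∧ dist s (d • A u) ≤ d / 8 + ε) ∧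
                (∀ s : EuclideanSpace ℝ (Fin 3), ν {s} ≠ 0 → s ≠ 0 → ‖s‖ + ε ≤ 13 / 10 * d →
                  ∃ u ∈ Literature.Geometry.DiscreteGeometry.fccKissingPattern, dist s (d • A u) ≤ d / 8 + ε)) ∨
              ((∀ u ∈ Literature.Geometry.DiscreteGeometry.hcpKissingPattern, ∃ s : EuclideanSpace ℝ (Fin 3), ν {s} ≠ 0 ∧ dist s (d • A u) ≤ d / 8 + ε) ∧
                (∀ s : EuclideanSpace ℝ (Fin 3), ν {s} ≠ 0 → s ≠ 0 → ‖s‖ + ε ≤ 13 / 10 * d →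
                  ∃ u ∈ Literature.Geometry.DiscreteGeometry.hcpKissingPattern, dist s (d • A u) ≤ d / 8 + ε)))) ∧
          ((∀ (d η γ : ℝ) (A : EuclideanSpace ℝ (Fin 3) →ₗᵢ[ℝ] EuclideanSpace ℝ (Fin 3)),
      (∀ t : ↥Literature.Geometry.DiscreteGeometry.fccKissingPattern → EuclideanSpace ℝ (Fin 3),
        ¬ (0 < d ∧ 0 < γ ∧ η < 1 / 20 ∧
          (∀ u : ↥Literature.Geometry.DiscreteGeometry.fccKissingPattern, ν {t u} ≠ 0 ∧ ‖(t u - 0) - d • A (u : EuclideanSpace ℝ (Fin 3))‖ ≤ η * d) ∧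
          (∀ s : EuclideanSpace ℝ (Fin 3), ν {s} ≠ 0 → s ≠ 0 → d ≤ dist s 0) ∧
          (∃ s : EuclideanSpace ℝ (Fin 3), ν {s} ≠ 0 ∧ s ≠ 0 ∧ dist s 0 ≤ d) ∧
          (∀ s : EuclideanSpace ℝ (Fin 3), ν {s} ≠ 0 → s ≠ 0 → dist s 0 < 13 / 10 * d + γ → dist s 0 ≤ 13 / 10 * d - γ ∧ s ∈ Set.range t))) ∧
      (∀ t : ↥Literature.Geometry.DiscreteGeometry.hcpKissingPattern → EuclideanSpace ℝ (Fin 3),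
        ¬ (0 < d ∧ 0 < γ ∧ η < 1 / 20 ∧
          (∀ u : ↥Literature.Geometry.DiscreteGeometry.hcpKissingPattern, ν {t u} ≠ 0 ∧ ‖(t u - 0) - d • A (u : EuclideanSpace ℝ (Fin 3))‖ ≤ η * d) ∧
          (∀ s : EuclideanSpace ℝ (Fin 3), ν {s} ≠ 0 → s ≠ 0 → d ≤ dist s 0) ∧
          (∃ s : EuclideanSpace ℝ (Fin 3), ν {s} ≠ 0 ∧ s ≠ 0 ∧ dist s 0 ≤ d) ∧
          (∀ s : EuclideanSpace ℝ (Fin 3), ν {s} ≠ 0 → s ≠ 0 → dist s 0 < 13 / 10 * d + γ → dist s 0 ≤ 13 / 10 * d - γ ∧ s ∈ Set.range t)))))} := by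
  intro δ hδ R₈ ε hε
  obtain ⟨C, hC⟩ := inv_le_prob_frustratedFineRoot δ hδ R₈ ε hε
  refine ⟨C, fun P => ?_⟩
  have hCP := hC P
  dsimp only at hCP ⊢
  intro hP ha hb R₇ R₉ hd
  rw [MeasureTheory.measure_eq_iInf]
  refine le_iInf₂ fun A hEA => le_iInf fun hA => ?_
  exact hCP hP ha hb R₇ R₉ hd A hA fun ν h1 h2 => hEA ⟨h1, h2⟩

/-- **hole-or-non-T root frequency, hull-free** — outer-measure form of `inv_le_prob_holeOrNonTRoot`. [this work] -/
theorem inv_le_prob_holeOrNonTRoot_hullFree :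
    ∀ δ : ℝ, 0 < δ → ∀ R₇ ε : ℝ, 0 < ε → ∃ C : ℕ,
    ∀ P : MeasureTheory.Measure (MeasureTheory.Measure (EuclideanSpace ℝ (Fin 3))), let Gy : ℝ → (N : ℕ) → (Fin N → EuclideanSpace ℝ (Fin 3)) → Fin N → Prop := fun η N y j => let d : ℝ := sInf ((fun z => dist z (y (j : Fin N))) '' (Set.range (y) \ {(y (j : Fin N))})); let T : Set (EuclideanSpace ℝ (Fin 3)) := {z : EuclideanSpace ℝ (Fin 3) | z ∈ Set.range (y) ∧ z ≠ (y (j : Fin N)) ∧ dist z (y (j : Fin N)) < 13 / 10 * d}; ∃ A : EuclideanSpace ℝ (Fin 3) →ₗᵢ[ℝ] EuclideanSpace ℝ (Fin 3), (∃ e : ↥T ≃ ↥Literature.Geometry.DiscreteGeometry.fccKissingPattern, ∀ t : ↥T, dist (d⁻¹ • ((t : EuclideanSpace ℝ (Fin 3)) - (y (j : Fin N)))) (A ((e t : ↥Literature.Geometry.DiscreteGeometry.fccKissingPattern) : EuclideanSpace ℝ (Fin 3))) ≤ η) ∨ (∃ e : ↥T ≃ ↥Literature.Geometry.DiscreteGeometry.hcpKissingPattern,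 ∀ t : ↥T, dist (d⁻¹ • ((t : EuclideanSpace ℝ (Fin 3)) - (y (j : Fin N)))) (A ((e t : ↥Literature.Geometry.DiscreteGeometry.hcpKissingPattern) : EuclideanSpace ℝ (Fin 3))) ≤ η); let TexBall : (N : ℕ) → (Fin N → EuclideanSpace ℝ (Fin 3)) → Fin N → ℝ → ℝ → ℝ → ℝ → Prop := fun N y i R R₇ R₈ R₉ => (∀ a b : Fin N, a ≠ b → (7 : ℝ) / 10 ≤ dist (y a) (y b)) ∧ (∀ j : Fin N, dist (y j) (y i) ≤ R → ¬ Gy (1 / 20) N (y) j) ∧ (∀ j : Fin N, dist (y j) (y i) ≤ R → ¬ ((∀ j' : Fin N, dist (y j') (y j) ≤ R₇ → ¬ Gy (1 / 20) N (y) j') ∧ (∀ z : EuclideanSpace ℝ (Fin 3), dist z (y j) ≤ R₇ → ∃ k : Fin N, dist z (y k) ≤ 1) ∧ (∀ j' : Fin N, dist (y j') (y j) ≤ R₇ → (let d : ℝ := sInf ((fun z => dist z (y j')) '' (Set.range (y) \ {(y j')})); ∀ k : Fin N, y k ≠ y j' → dist (y k) (y j') < 27 / 20 * d → 5 ≤ Nat.card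 {m : Fin N // y m ≠ y j' ∧ dist (y m) (y j') < 27 / 20 * d ∧ y m ≠ y k ∧ dist (y m) (y k) < 27 / 20 * d})))) ∧ (∀ j : Fin N, dist (y j) (y i) ≤ R → ∃ k : Fin N, dist (y k) (y j) ≤ R₈ ∧ Gy (1 / 8) N (y) k) ∧ (∀ j : Fin N, dist (y j) (y i) ≤ R → ¬ ((∀ j' : Fin N, dist (y j') (y j) ≤ R₉ → ¬ Gy (1 / 20) N (y) j') ∧ (Nat.card {j' : Fin N // dist (y j') (y j) ≤ R₉ ∧ ¬ Gy (1 / 8) N (y) j'} : ℝ) ≤ 1 / 2 * (Nat.card {j' : Fin N // dist (y j') (y j) ≤ R₉} : ℝ) ∧ (∀ j' : Fin N, dist (y j') (y j) ≤ R₉ → ¬ Gy (1 / 8) N (y) j' → ¬ (let d : ℝ := sInf ((fun z => dist z (y j')) '' (Set.range (y) \ {(y j')})); ∀ k : Fin N, y k ≠ y j' → dist (y k) (y j') < 27 / 20 * d → 5 ≤ Nat.card {m : Fin N // y m ≠ y j' ∧ dist (y m) (y j') < 27 / 20 * d ∧ y m ≠ y k ∧ dist (y m) (y k) < 27 / 20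 * d})))); let Appr : MeasureTheory.Measure (EuclideanSpace ℝ (Fin 3)) → ℝ → ℝ → ℝ → Prop := fun μ R₇ R₈ R₉ => ∀ q : EuclideanSpace ℝ (Fin 3), μ {q} ≠ 0 → ∀ R ε : ℝ, 0 < ε → ∃ (N : ℕ) (y : Fin N → EuclideanSpace ℝ (Fin 3)) (i : Fin N), TexBall N y i R R₇ R₈ R₉ ∧ (∀ p : EuclideanSpace ℝ (Fin 3), μ {p} ≠ 0 → dist p q ≤ R → ∃ k : Fin N, dist (y k - y i) (p - q) ≤ ε) ∧ (∀ k : Fin N, dist (y k) (y i) ≤ R → ∃ p : EuclideanSpace ℝ (Fin 3), μ {p} ≠ 0 ∧ dist (y k - y i) (p - q) ≤ ε);  MeasureTheory.IsProbabilityMeasure P → (∀ᵐ μ ∂P, Literature.Probability.Process.IsRootedHardCore δ μ) → Literature.Probability.Process.IsPointStationaryLaw P → ∀ R₈ R₉ : ℝ, (∀ᵐ μ ∂P, Appr μ R₇ R₈ R₉) →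
        (C : ℝ≥0∞)⁻¹ ≤ P {ν : MeasureTheory.Measure (EuclideanSpace ℝ (Fin 3)) |
          (((∃ z : EuclideanSpace ℝ (Fin 3), ‖z‖ ≤ R₇ + ε ∧ ∀ s : EuclideanSpace ℝ (Fin 3), ν {s} ≠ 0 → 1 - ε ≤ dist s z) ∨
          (∃ d' : ℝ, (7 : ℝ) / 10 ≤ d' ∧
      (∀ s : EuclideanSpace ℝ (Fin 3), ν {s} ≠ 0 → s ≠ 0 → d' ≤ dist s 0 + ε) ∧ (∃ s : EuclideanSpace ℝ (Fin 3), ν {s} ≠ 0 ∧ s ≠ 0 ∧ dist s 0 ≤ d' + ε) ∧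
      ∃ p' : EuclideanSpace ℝ (Fin 3), ν {p'} ≠ 0 ∧ p' ≠ 0 ∧ dist p' 0 ≤ 27 / 20 * d' + ε ∧
        Nat.card {m : EuclideanSpace ℝ (Fin 3) // ν {m} ≠ 0 ∧ m ≠ 0 ∧ dist m 0 + ε ≤ 27 / 20 * d' ∧ m ≠ p' ∧ dist m p' + ε ≤ 27 / 20 * d'} ≤ 4)))} := by
  intro δ hδ R₇ ε hε
  obtain ⟨C, hC⟩ := inv_le_prob_holeOrNonTRoot δ hδ R₇ ε hε
  refine ⟨C, fun P => ?_⟩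
  have hCP := hC P
  dsimp only at hCP ⊢
  intro hP ha hb R₈ R₉ hd
  rw [MeasureTheory.measure_eq_iInf]
  refine le_iInf₂ fun A hEA => le_iInf fun hA => ?_
  exact hCP hP ha hb R₈ R₉ hd A hA fun ν h1 => hEA h1

/-- **coarse-root frequency, hull-free** — outer-measure form of `inv_le_prob_coarseRoot`. [this work] -/
theorem inv_le_prob_coarseRoot_hullFree :
    ∀ δ : ℝ, 0 < δ → ∀ R₉ : ℝ, ∃ C : ℕ,
    ∀ P : MeasureTheory.Measure (MeasureTheory.Measure (EuclideanSpace ℝ (Fin 3))), let Gy : ℝ → (N : ℕ) → (Fin N → EuclideanSpace ℝ (Fin 3)) → Fin N → Prop := fun η N y j => let d : ℝ := sInf ((fun z => dist z (y (j : Fin N))) '' (Set.range (y) \ {(y (j : Fin N))})); let T : Set (EuclideanSpace ℝ (Fin 3)) := {z : EuclideanSpace ℝ (Fin 3) | z ∈ Set.range (y) ∧ z ≠ (y (j : Fin N)) ∧ dist z (y (j : Fin N)) < 13 / 10 * d}; ∃ A : EuclideanSpace ℝ (Fin 3) →ₗᵢ[ℝ] EuclideanSpace ℝ (Fin 3), (∃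 e : ↥T ≃ ↥Literature.Geometry.DiscreteGeometry.fccKissingPattern, ∀ t : ↥T, dist (d⁻¹ • ((t : EuclideanSpace ℝ (Fin 3)) - (y (j : Fin N)))) (A ((e t : ↥Literature.Geometry.DiscreteGeometry.fccKissingPattern) : EuclideanSpace ℝ (Fin 3))) ≤ η) ∨ (∃ e : ↥T ≃ ↥Literature.Geometry.DiscreteGeometry.hcpKissingPattern, ∀ t : ↥T, dist (d⁻¹ • ((t : EuclideanSpace ℝ (Fin 3)) - (y (j : Fin N)))) (A ((e t : ↥Literature.Geometry.DiscreteGeometry.hcpKissingPattern) : EuclideanSpace ℝ (Fin 3))) ≤ η); let TexBall : (N : ℕ) → (Fin N → EuclideanSpace ℝ (Fin 3)) → Fin N → ℝ → ℝ → ℝ → ℝ → Prop := fun N y i R R₇ R₈ R₉ => (∀ a b : Fin N, a ≠ b → (7 : ℝ) / 10 ≤ dist (y a) (y b)) ∧ (∀ j : Fin N, dist (y j) (y i) ≤ R → ¬ Gy (1 / 20) N (y) j) ∧ (∀ j : Fin N, dist (y j) (y i) ≤ R → ¬ ((∀ j' : Fin N, dist (y j') (y j) ≤ R₇ → ¬ Gy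 (1 / 20) N (y) j') ∧ (∀ z : EuclideanSpace ℝ (Fin 3), dist z (y j) ≤ R₇ → ∃ k : Fin N, dist z (y k) ≤ 1) ∧ (∀ j' : Fin N, dist (y j') (y j) ≤ R₇ → (let d : ℝ := sInf ((fun z => dist z (y j')) '' (Set.range (y) \ {(y j')})); ∀ k : Fin N, y k ≠ y j' → dist (y k) (y j') < 27 / 20 * d → 5 ≤ Nat.card {m : Fin N // y m ≠ y j' ∧ dist (y m) (y j') < 27 / 20 * d ∧ y m ≠ y k ∧ dist (y m) (y k) < 27 / 20 * d})))) ∧ (∀ j : Fin N, dist (y j) (y i) ≤ R → ∃ k : Fin N, dist (y k) (y j) ≤ R₈ ∧ Gy (1 / 8) N (y) k) ∧ (∀ j : Fin N, dist (y j) (y i) ≤ R → ¬ ((∀ j' : Fin N, dist (y j') (y j) ≤ R₉ → ¬ Gy (1 / 20) N (y) j') ∧ (Nat.card {j' : Fin N // dist (y j') (y j) ≤ R₉ ∧ ¬ Gy (1 / 8) N (y) j'} : ℝ) ≤ 1 / 2 * (Nat.card {j' : Fin N // dist (y j') (y j) ≤ R₉} : ℝ) ∧ (∀ j' : Fin N,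 dist (y j') (y j) ≤ R₉ → ¬ Gy (1 / 8) N (y) j' → ¬ (let d : ℝ := sInf ((fun z => dist z (y j')) '' (Set.range (y) \ {(y j')})); ∀ k : Fin N, y k ≠ y j' → dist (y k) (y j') < 27 / 20 * d → 5 ≤ Nat.card {m : Fin N // y m ≠ y j' ∧ dist (y m) (y j') < 27 / 20 * d ∧ y m ≠ y k ∧ dist (y m) (y k) < 27 / 20 * d})))); let Appr : MeasureTheory.Measure (EuclideanSpace ℝ (Fin 3)) → ℝ → ℝ → ℝ → Prop := fun μ R₇ R₈ R₉ => ∀ q : EuclideanSpace ℝ (Fin 3), μ {q} ≠ 0 → ∀ R ε : ℝ, 0 < ε → ∃ (N : ℕ) (y : Fin N → EuclideanSpace ℝ (Fin 3)) (i : Fin N), TexBall N y i R R₇ R₈ R₉ ∧ (∀ p : EuclideanSpace ℝ (Fin 3), μ {p} ≠ 0 → dist p q ≤ R → ∃ k : Fin N, dist (y k - y i) (p - q) ≤ ε) ∧ (∀ k : Fin N, dist (y k) (y i) ≤ R → ∃ p : EuclideanSpace ℝ (Fin 3), μ {p} ≠ 0 ∧ dist (y k - y i) (p - q) ≤ ε);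  MeasureTheory.IsProbabilityMeasure P → (∀ᵐ μ ∂P, Literature.Probability.Process.IsRootedHardCore δ μ) → Literature.Probability.Process.IsPointStationaryLaw P → ∀ R₇ R₈ : ℝ, (∀ᵐ μ ∂P, Appr μ R₇ R₈ R₉) →
        (C : ℝ≥0∞)⁻¹ ≤ P {ν : MeasureTheory.Measure (EuclideanSpace ℝ (Fin 3)) |
          ((∀ (d η γ : ℝ) (A : EuclideanSpace ℝ (Fin 3) →ₗᵢ[ℝ] EuclideanSpace ℝ (Fin 3)),
      (∀ t : ↥Literature.Geometry.DiscreteGeometry.fccKissingPattern → EuclideanSpace ℝ (Fin 3),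
        ¬ (0 < d ∧ 0 < γ ∧ η < 1 / 8 ∧
          (∀ u : ↥Literature.Geometry.DiscreteGeometry.fccKissingPattern, ν {t u} ≠ 0 ∧ ‖(t u - 0) - d • A (u : EuclideanSpace ℝ (Fin 3))‖ ≤ η * d) ∧
          (∀ s : EuclideanSpace ℝ (Fin 3), ν {s} ≠ 0 → s ≠ 0 → d ≤ dist s 0) ∧
          (∃ s : EuclideanSpace ℝ (Fin 3), ν {s} ≠ 0 ∧ s ≠ 0 ∧ dist s 0 ≤ d) ∧
          (∀ s : EuclideanSpace ℝ (Fin 3), ν {s} ≠ 0 → s ≠ 0 → dist s 0 < 13 / 10 * d + γ → dist s 0 ≤ 13 / 10 * d - γ ∧ s ∈ Set.range t))) ∧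
      (∀ t : ↥Literature.Geometry.DiscreteGeometry.hcpKissingPattern → EuclideanSpace ℝ (Fin 3),
        ¬ (0 < d ∧ 0 < γ ∧ η < 1 / 8 ∧
          (∀ u : ↥Literature.Geometry.DiscreteGeometry.hcpKissingPattern, ν {t u} ≠ 0 ∧ ‖(t u - 0) - d • A (u : EuclideanSpace ℝ (Fin 3))‖ ≤ η * d) ∧
          (∀ s : EuclideanSpace ℝ (Fin 3), ν {s} ≠ 0 → s ≠ 0 → d ≤ dist s 0) ∧
          (∃ s : EuclideanSpace ℝ (Fin 3), ν {s} ≠ 0 ∧ s ≠ 0 ∧ dist s 0 ≤ d) ∧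
          (∀ s : EuclideanSpace ℝ (Fin 3), ν {s} ≠ 0 → s ≠ 0 → dist s 0 < 13 / 10 * d + γ → dist s 0 ≤ 13 / 10 * d - γ ∧ s ∈ Set.range t)))))} := by
  intro δ hδ R₉
  obtain ⟨C, hC⟩ := inv_le_prob_coarseRoot δ hδ R₉
  refine ⟨C, fun P => ?_⟩
  have hCP := hC P
  dsimp only at hCP ⊢
  intro hP ha hb R₇ R₈ hd
  rw [MeasureTheory.measure_eq_iInf]
  refine le_iInf₂ fun A hEA => le_iInf fun hA => ?_
  exact hCP hP ha hb R₇ R₈ hd A hA fun ν h1 => hEA h1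

end Summit.AtomisticToContinuum.Crystallization.Theorems.FrustratedLawDichotomyFrequencyHullFree

end
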